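import Summits.HodgeConjecture.HodgeConjecture.Theses.HeckePrymWeil

/-!
# `WeilTwelvefoldsSqrtMinus7` (stmt-HodgeConjecture-1261) · Negative · arithmetic of the eigenvalue typing

Negative-side / tightness knowledge for the crux `HeckePrymWeil.WeilTwelvefoldsSqrtMinus7` (and every
rung of the `p = 7` ladder `HodgeWeilLadder`, `WeilSixfoldsSqrtMinus7`, `WeilDescending` at `p = 7`),
extracted from the standing disprover's work file `Cruxes/WeilTwelvefoldsSqrtMinus7/Disproof.lean`
(refuter-cdisprove-stmt-HodgeConjecture-1261-0, cycle 1, 2026-08-16), all unconditional: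

The route types the Weil plane `W_K ⊗ ℂ = ∧^{2n}V_σ ⊕ ∧^{2n}V_σ̄` of `(A, φ)`, `φ ∘ φ = -7`, as
`Eig((𝟙+φ)^*, (1+i√7)^{2n}) ⊔ Eig((𝟙+φ)^*, (1-i√7)^{2n})`, a SINGLE test endomorphism (the tree's
`HodgeTheory.weilClassesOf` uses all `x·𝟙 + y·φ` and separates by varying `x`,
`HodgeTheory.exists_nat_pow_ne_and`).  That this single operator already isolates the Weil plane in
`∧^{2n}(V_σ ⊕ V_σ̄)` for EVERY `n` is the content of

* `one_add_I_sqrt7_pow_ne` : `(1+i√7)^n ≠ (1-i√7)^n` for all `n ≥ 1` — `(1-i√7)/(1+i√7)` is no root of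
  unity; proof by 2-adic parity in `ℤ[√-7]` (`one_add_sqrtNeg7_pow_dyadic`:
  `(1+√-7)^(n+1) = 2^n (a + b√-7)`, `a ≡ b (mod 4)`, `a` odd);
* `mixed_eq_plus_iff`, `mixed_eq_minus_iff` : the mixed eigenvalue `(1+i√7)^a (1-i√7)^b` of
  `∧^aV_σ ⊗ ∧^bV_σ̄` equals `(1+i√7)^{a+b}` iff `b = 0` (resp. `(1-i√7)^{a+b}` iff `a = 0`);
* `one_add_I_sqrt7_pow_twelve` : `(1+i√7)^12 = -96256 + 92160·i√7` — not real, so a non-zero rational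
  class never lies in ONE typed eigenspace of the crux, only in the sum;

and that the device is TIGHT in its side conditions (refuted strengthenings):

* `typing_fails_sqrt3` : for `K = ℚ(√-3)`, `(1+i√3)^3 (1-i√3)^9 = (1+i√3)^12 = (1-i√3)^12` — the typed
  space would swallow mixed summands (why the ladder demands `7 ≤ p`);
* `typing_fails_gauss` : for `K = ℚ(i)`, `(1+i)^4 = (1-i)^4`;
* `phiStar_does_not_separate` : `φ^*` itself has eigenvalue `(i√7)^6(-i√7)^6 = (i√7)^12` on the balanced
  mixed summand `∧⁶V_σ ⊗ ∧⁶V_σ̄` (why the crux uses `(𝟙+φ)^*`, not `φ^*`).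
-/

noncomputable section

open Complex

namespace Summit.HodgeConjecture.HodgeConjecture.Theorems.WeilTwelvefoldsSqrtMinus7.Negative

/-! Spelling: `√7 = ((Real.sqrt (7 : ℝ) : ℝ) : ℂ)` exactly as in the crux; `1 + √-7 = (⟨1, 1⟩ : ℤ√(-7))`. -/

/-! ## `√7` and the two embeddings `ℤ[√-7] → ℂ` -/

/-- `√7 · √7 = 7` in `ℂ`. [folklore] -/
theorem sqrt7_mul_sqrt7 : ((Real.sqrt (7 : ℝ) : ℝ) : ℂ) * ((Real.sqrt (7 : ℝ) : ℝ) : ℂ) = 7 := by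
  rw [← Complex.ofReal_mul, Real.mul_self_sqrt (by norm_num : (0 : ℝ) ≤ 7)]
  push_cast
  rfl

/-- `√7 ≠ 0` in `ℂ`. [folklore] -/
theorem sqrt7_ne_zero : ((Real.sqrt (7 : ℝ) : ℝ) : ℂ) ≠ 0 := by
  simp only [ne_eq, Complex.ofReal_eq_zero]
  exact (Real.sqrt_pos.2 (by norm_num : (0 : ℝ) < 7)).ne'

/-- `(i√7)² = -7`, in the shape `Zsqrtd.lift` wants. [folklore] -/
theorem I_mul_sqrt7_mul_self : (I * ((Real.sqrt (7 : ℝ) : ℝ) : ℂ)) * (I * ((Real.sqrt (7 : ℝ) : ℝ) : ℂ)) = ((-7 : ℤ) : ℂ) := by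
  have h : (I * ((Real.sqrt (7 : ℝ) : ℝ) : ℂ)) * (I * ((Real.sqrt (7 : ℝ) : ℝ) : ℂ)) = (I * I) * (((Real.sqrt (7 : ℝ) : ℝ) : ℂ) * ((Real.sqrt (7 : ℝ) : ℝ) : ℂ)) := by ring
  rw [h, I_mul_I, sqrt7_mul_sqrt7]
  push_cast
  ring

/-- `(-i√7)² = -7`. [folklore] -/
theorem neg_I_mul_sqrt7_mul_self : (-(I * ((Real.sqrt (7 : ℝ) : ℝ) : ℂ))) * (-(I * ((Real.sqrt (7 : ℝ) : ℝ) : ℂ))) = ((-7 : ℤ) : ℂ) := by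
  rw [neg_mul_neg]
  exact I_mul_sqrt7_mul_self

/-- `(1+i√7)^n` read off from `(1+√-7)^n ∈ ℤ[√-7]` through the embedding `√-7 ↦ i√7`
(Mathlib `Zsqrtd.lift`). [folklore] -/
theorem one_add_I_sqrt7_pow (n : ℕ) :
    (1 + I * ((Real.sqrt (7 : ℝ) : ℝ) : ℂ)) ^ n = (((⟨1, 1⟩ : ℤ√(-7)) ^ n).re : ℂ) + (((⟨1, 1⟩ : ℤ√(-7)) ^ n).im : ℂ) * (I * ((Real.sqrt (7 : ℝ) : ℝ) : ℂ)) := by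
  have h1 : Zsqrtd.lift ⟨I * ((Real.sqrt (7 : ℝ) : ℝ) : ℂ), I_mul_sqrt7_mul_self⟩ (⟨1, 1⟩ : ℤ√(-7)) = 1 + I * ((Real.sqrt (7 : ℝ) : ℝ) : ℂ) := by
    rw [Zsqrtd.lift_apply_apply]; push_cast; ring
  rw [← h1, ← map_pow, Zsqrtd.lift_apply_apply]

/-- `(1-i√7)^n` read off from `(1+√-7)^n ∈ ℤ[√-7]` through the conjugate embedding `√-7 ↦ -i√7`.
[folklore] -/
theorem one_sub_I_sqrt7_pow (n : ℕ) :
    (1 - I * ((Real.sqrt (7 : ℝ) : ℝ) : ℂ)) ^ n = (((⟨1, 1⟩ : ℤ√(-7)) ^ n).re : ℂ) - (((⟨1, 1⟩ : ℤ√(-7)) ^ n).im : ℂ) * (I * ((Real.sqrt (7 : ℝ) : ℝ) : ℂ)) := by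
  have h1 : Zsqrtd.lift ⟨-(I * ((Real.sqrt (7 : ℝ) : ℝ) : ℂ)), neg_I_mul_sqrt7_mul_self⟩ (⟨1, 1⟩ : ℤ√(-7)) = 1 - I * ((Real.sqrt (7 : ℝ) : ℝ) : ℂ) := by
    rw [Zsqrtd.lift_apply_apply]; push_cast; ring
  rw [← h1, ← map_pow, Zsqrtd.lift_apply_apply]
  push_cast
  ring

/-! ## 2-adic parity in `ℤ[√-7]` and eigenvalue separation for all exponents -/

/-- **2-adic parity.** `(1+√-7)^(n+1) = 2^n · (a + b√-7)` with `a ≡ b (mod 4)` and `a` odd (so `b` odd).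
Mechanism: `π = (1+√-7)/2` is a prime of norm `2` in `O_K`, `K = ℚ(√-7)`, and `π^m mod 2O_K` never meets the
image of the real suborder; done here by bare integer arithmetic. [folklore] -/
theorem one_add_sqrtNeg7_pow_dyadic (n : ℕ) : ∃ a b : ℤ,
    ((⟨1, 1⟩ : ℤ√(-7)) ^ (n + 1)).re = 2 ^ n * a ∧ ((⟨1, 1⟩ : ℤ√(-7)) ^ (n + 1)).im = 2 ^ n * b ∧ a % 4 = b % 4 ∧ a % 2 = 1 := by
  induction n with
  | zero => exact ⟨1, 1, by simp, by simp, rfl, rfl⟩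
  | succ n ih =>
    obtain ⟨a, b, hre, him, h4, h2⟩ := ih
    refine ⟨(a - 7 * b) / 2, (a + b) / 2, ?_, ?_, by omega, by omega⟩
    · have e : 2 * ((a - 7 * b) / 2) = a - 7 * b := by omega
      have e' : (2 : ℤ) ^ (n + 1) * ((a - 7 * b) / 2) = 2 ^ n * (a - 7 * b) := by
        rw [pow_succ, mul_assoc, e]
      rw [pow_succ _ (n + 1), Zsqrtd.re_mul, hre, him, e']
      ring
    · have e : 2 * ((a + b) / 2) = a + b := by omega
      have e' : (2 : ℤ) ^ (n + 1) * ((a + b) / 2) = 2 ^ n * (a + b) := by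
        rw [pow_succ, mul_assoc, e]
      rw [pow_succ _ (n + 1), Zsqrtd.im_mul, hre, him, e']
      ring

/-- The `√-7`-coordinate of `(1+√-7)^n` never vanishes (`n ≥ 1`). [folklore] -/
theorem im_one_add_sqrtNeg7_pow_ne_zero (n : ℕ) (hn : 1 ≤ n) : ((⟨1, 1⟩ : ℤ√(-7)) ^ n).im ≠ 0 := by
  obtain ⟨m, rfl⟩ : ∃ m, n = m + 1 := ⟨n - 1, by omega⟩
  obtain ⟨a, b, -, him, h4, h2⟩ := one_add_sqrtNeg7_pow_dyadic m
  rw [him]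
  have hb : b ≠ 0 := by omega
  exact mul_ne_zero (pow_ne_zero _ two_ne_zero) hb

/-- **Eigenvalue separation at `p = 7`, every exponent**: `(1+i√7)^n ≠ (1-i√7)^n` for `n ≥ 1`, i.e.
`(1-i√7)/(1+i√7) = (-3-i√7)/4` (norm `1`, minimal polynomial `2x²+3x+2`) is no root of unity.  Behind the
route's typing of the Weil plane by the single operator `(𝟙+φ)^*` and the `λ ≠ λ̄` step of `WeilDescending`
at `p = 7`. [folklore] -/
theorem one_add_I_sqrt7_pow_ne (n : ℕ) (hn : 1 ≤ n) : (1 + I * ((Real.sqrt (7 : ℝ) : ℝ) : ℂ)) ^ n ≠ (1 - I * ((Real.sqrt (7 : ℝ) : ℝ) : ℂ)) ^ n := by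
  intro h
  rw [one_add_I_sqrt7_pow, one_sub_I_sqrt7_pow] at h
  have h2 : (2 * (((⟨1, 1⟩ : ℤ√(-7)) ^ n).im : ℂ)) * (I * ((Real.sqrt (7 : ℝ) : ℝ) : ℂ)) = 0 := by linear_combination h
  have hne : (2 * (((⟨1, 1⟩ : ℤ√(-7)) ^ n).im : ℂ)) * (I * ((Real.sqrt (7 : ℝ) : ℝ) : ℂ)) ≠ 0 :=
    mul_ne_zero (mul_ne_zero two_ne_zero (Int.cast_ne_zero.2 (im_one_add_sqrtNeg7_pow_ne_zero n hn)))
      (mul_ne_zero I_ne_zero sqrt7_ne_zero)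
  exact hne h2

/-- `1 + i√7 ≠ 0`. [folklore] -/
theorem one_add_I_sqrt7_ne_zero : (1 + I * ((Real.sqrt (7 : ℝ) : ℝ) : ℂ)) ≠ 0 := by
  intro h
  have := congrArg Complex.re h
  simp at this

/-- `1 - i√7 ≠ 0`. [folklore] -/
theorem one_sub_I_sqrt7_ne_zero : (1 - I * ((Real.sqrt (7 : ℝ) : ℝ) : ℂ)) ≠ 0 := by
  intro h
  have := congrArg Complex.re h
  simp at this

/-- **No mixed eigenvalue reaches the `σ`-Weil eigenvalue**: `(1+i√7)^a (1-i√7)^b = (1+i√7)^{a+b} ↔ b = 0`.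
In `∧^{a+b}(V_σ ⊕ V_σ̄)` this says `Eig((𝟙+φ)^*, (1+i√7)^{2n}) = ∧^{2n}V_σ` exactly (granted
`H^{2n}(A) = ∧^{2n}H¹(A)`). [folklore] -/
theorem mixed_eq_plus_iff (a b : ℕ) :
    (1 + I * ((Real.sqrt (7 : ℝ) : ℝ) : ℂ)) ^ a * (1 - I * ((Real.sqrt (7 : ℝ) : ℝ) : ℂ)) ^ b = (1 + I * ((Real.sqrt (7 : ℝ) : ℝ) : ℂ)) ^ (a + b) ↔ b = 0 := by
  refine ⟨fun h => ?_, fun h => by subst h; simp⟩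
  by_contra hb
  rw [pow_add] at h
  exact one_add_I_sqrt7_pow_ne b (Nat.one_le_iff_ne_zero.2 hb)
    (mul_left_cancel₀ (pow_ne_zero a one_add_I_sqrt7_ne_zero) h).symm

/-- Mirror: `(1+i√7)^a (1-i√7)^b = (1-i√7)^{a+b} ↔ a = 0`. [folklore] -/
theorem mixed_eq_minus_iff (a b : ℕ) :
    (1 + I * ((Real.sqrt (7 : ℝ) : ℝ) : ℂ)) ^ a * (1 - I * ((Real.sqrt (7 : ℝ) : ℝ) : ℂ)) ^ b = (1 - I * ((Real.sqrt (7 : ℝ) : ℝ) : ℂ)) ^ (a + b) ↔ a = 0 := by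
  refine ⟨fun h => ?_, fun h => by subst h; simp⟩
  by_contra ha
  rw [pow_add] at h
  exact one_add_I_sqrt7_pow_ne a (Nat.one_le_iff_ne_zero.2 ha)
    (mul_right_cancel₀ (pow_ne_zero b one_sub_I_sqrt7_ne_zero) h)

/-- The crux exponent `2n = 12`: the two typed eigenvalues of the crux differ (its `⊔` is direct and
`(𝟙+φ)^*` separates `w₊` from `w₋`). [folklore] -/
theorem weilEigenvalues_twelve_ne : (1 + I * ((Real.sqrt (7 : ℝ) : ℝ) : ℂ)) ^ 12 ≠ (1 - I * ((Real.sqrt (7 : ℝ) : ℝ) : ℂ)) ^ 12 :=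
  one_add_I_sqrt7_pow_ne 12 (by norm_num)

/-- The crux exponent: for `a + b = 12` the mixed eigenvalue hits `(1 ± i√7)^12` only at the two ends.
[folklore] -/
theorem mixed_twelve (a b : ℕ) (hab : a + b = 12) :
    ((1 + I * ((Real.sqrt (7 : ℝ) : ℝ) : ℂ)) ^ a * (1 - I * ((Real.sqrt (7 : ℝ) : ℝ) : ℂ)) ^ b = (1 + I * ((Real.sqrt (7 : ℝ) : ℝ) : ℂ)) ^ 12 ↔ b = 0) ∧
    ((1 + I * ((Real.sqrt (7 : ℝ) : ℝ) : ℂ)) ^ a * (1 - I * ((Real.sqrt (7 : ℝ) : ℝ) : ℂ)) ^ b = (1 - I * ((Real.sqrt (7 : ℝ) : ℝ) : ℂ)) ^ 12 ↔ a = 0) := by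
  rw [← hab]
  exact ⟨mixed_eq_plus_iff a b, mixed_eq_minus_iff a b⟩

/-! ## The explicit value at exponent 12 -/

/-- `(1+√-7)^12 = -96256 + 92160·√-7` in `ℤ[√-7]` (kernel computation; `96256² + 7·92160² = 2³⁶`).
[folklore] -/
theorem one_add_sqrtNeg7_pow_twelve : (⟨1, 1⟩ : ℤ√(-7)) ^ 12 = ⟨-96256, 92160⟩ := by decide

/-- **Explicit typed eigenvalue** `(1+i√7)^12 = -96256 + 92160·i√7`. [folklore] -/
theorem one_add_I_sqrt7_pow_twelve :
    (1 + I * ((Real.sqrt (7 : ℝ) : ℝ) : ℂ)) ^ 12 = (-96256 : ℂ) + (92160 : ℂ) * (I * ((Real.sqrt (7 : ℝ) : ℝ) : ℂ)) := by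
  rw [one_add_I_sqrt7_pow, one_add_sqrtNeg7_pow_twelve]
  push_cast
  ring

/-- `(1-i√7)^12 = -96256 - 92160·i√7`. [folklore] -/
theorem one_sub_I_sqrt7_pow_twelve :
    (1 - I * ((Real.sqrt (7 : ℝ) : ℝ) : ℂ)) ^ 12 = (-96256 : ℂ) - (92160 : ℂ) * (I * ((Real.sqrt (7 : ℝ) : ℝ) : ℂ)) := by
  rw [one_sub_I_sqrt7_pow, one_add_sqrtNeg7_pow_twelve]
  push_cast
  ring

/-- `(1+i√7)^12` is NOT real: a non-zero rational (conjugation-invariant) class cannot lie in a single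
typed eigenspace of the real operator `(𝟙+φ)^*`, only in the sum `w₊ + w₋`. [folklore] -/
theorem one_add_I_sqrt7_pow_twelve_im_ne_zero : ((1 + I * ((Real.sqrt (7 : ℝ) : ℝ) : ℂ)) ^ 12).im ≠ 0 := by
  rw [one_add_I_sqrt7_pow_twelve]
  simp

/-! ## Refuted strengthenings of the typing device -/

/-- `(i√3)² = -3`. [folklore] -/
theorem I_mul_sqrt3_sq : (I * ((Real.sqrt (3 : ℝ) : ℝ) : ℂ)) ^ 2 = -3 := by
  have h3 : ((Real.sqrt (3 : ℝ) : ℝ) : ℂ) * ((Real.sqrt (3 : ℝ) : ℝ) : ℂ) = 3 := by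
    rw [← Complex.ofReal_mul, Real.mul_self_sqrt (by norm_num : (0 : ℝ) ≤ 3)]
    push_cast
    rfl
  have h : (I * ((Real.sqrt (3 : ℝ) : ℝ) : ℂ)) ^ 2 = (I * I) * (((Real.sqrt (3 : ℝ) : ℝ) : ℂ) * ((Real.sqrt (3 : ℝ) : ℝ) : ℂ)) := by ring
  rw [h, I_mul_I, h3]
  ring

/-- `(1+i√3)^3 = -8` (`1+i√3 = 2e^{iπ/3}`). [folklore] -/
theorem one_add_I_sqrt3_cube : (1 + I * ((Real.sqrt (3 : ℝ) : ℝ) : ℂ)) ^ 3 = -8 := by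
  have h : (1 + I * ((Real.sqrt (3 : ℝ) : ℝ) : ℂ)) ^ 3 = 1 + 3 * (I * ((Real.sqrt (3 : ℝ) : ℝ) : ℂ)) + 3 * (I * ((Real.sqrt (3 : ℝ) : ℝ) : ℂ)) ^ 2 + (I * ((Real.sqrt (3 : ℝ) : ℝ) : ℂ)) ^ 2 * (I * ((Real.sqrt (3 : ℝ) : ℝ) : ℂ)) := by
    ring
  rw [h, I_mul_sqrt3_sq]
  ring

/-- `(1-i√3)^3 = -8`. [folklore] -/
theorem one_sub_I_sqrt3_cube : (1 - I * ((Real.sqrt (3 : ℝ) : ℝ) : ℂ)) ^ 3 = -8 := by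
  have h : (1 - I * ((Real.sqrt (3 : ℝ) : ℝ) : ℂ)) ^ 3 = 1 - 3 * (I * ((Real.sqrt (3 : ℝ) : ℝ) : ℂ)) + 3 * (I * ((Real.sqrt (3 : ℝ) : ℝ) : ℂ)) ^ 2 - (I * ((Real.sqrt (3 : ℝ) : ℝ) : ℂ)) ^ 2 * (I * ((Real.sqrt (3 : ℝ) : ℝ) : ℂ)) := by
    ring
  rw [h, I_mul_sqrt3_sq]
  ring

/-- **The typing fails for `K = ℚ(√-3)`**: `(1+i√3)/(1-i√3)` is a primitive cube root of unity, so at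
exponent 12 the would-be Weil eigenvalue coincides with the mixed eigenvalue of `∧⁹V_σ ⊗ ∧³V_σ̄` and with
its conjugate — the route's `7 ≤ p` is load-bearing for the MEANING of every rung. [folklore] -/
theorem typing_fails_sqrt3 :
    (1 + I * ((Real.sqrt (3 : ℝ) : ℝ) : ℂ)) ^ 3 * (1 - I * ((Real.sqrt (3 : ℝ) : ℝ) : ℂ)) ^ 9 = (1 + I * ((Real.sqrt (3 : ℝ) : ℝ) : ℂ)) ^ 12 ∧
      (1 + I * ((Real.sqrt (3 : ℝ) : ℝ) : ℂ)) ^ 12 = (1 - I * ((Real.sqrt (3 : ℝ) : ℝ) : ℂ)) ^ 12 := by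
  have h9 : (1 - I * ((Real.sqrt (3 : ℝ) : ℝ) : ℂ)) ^ 9 = ((1 - I * ((Real.sqrt (3 : ℝ) : ℝ) : ℂ)) ^ 3) ^ 3 := by ring
  have h12 : (1 + I * ((Real.sqrt (3 : ℝ) : ℝ) : ℂ)) ^ 12 = ((1 + I * ((Real.sqrt (3 : ℝ) : ℝ) : ℂ)) ^ 3) ^ 4 := by ring
  have h12' : (1 - I * ((Real.sqrt (3 : ℝ) : ℝ) : ℂ)) ^ 12 = ((1 - I * ((Real.sqrt (3 : ℝ) : ℝ) : ℂ)) ^ 3) ^ 4 := by ring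
  refine ⟨?_, ?_⟩
  · rw [h9, h12, one_add_I_sqrt3_cube, one_sub_I_sqrt3_cube]; norm_num
  · rw [h12, h12', one_add_I_sqrt3_cube, one_sub_I_sqrt3_cube]

/-- **The typing fails for `K = ℚ(i)`** (`(1+i)/(1-i) = i`): `(1+i)^4 = (1-i)^4`. [folklore] -/
theorem typing_fails_gauss : (1 + I) ^ 4 = (1 - I) ^ 4 := by
  linear_combination (8 * I) * I_sq

/-- **`φ^*` does not separate**: on `∧^aV_σ ⊗ ∧^bV_σ̄` the eigenvalue of `φ^*` is `(i√7)^a(-i√7)^b`; for the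
balanced summand `(a,b) = (6,6)` it equals the Weil eigenvalue `(i√7)^12 = (-i√7)^12` — the reason the
crux is typed with `(𝟙+φ)^*`. [folklore] -/
theorem phiStar_does_not_separate :
    (I * ((Real.sqrt (7 : ℝ) : ℝ) : ℂ)) ^ 6 * (-(I * ((Real.sqrt (7 : ℝ) : ℝ) : ℂ))) ^ 6 = (I * ((Real.sqrt (7 : ℝ) : ℝ) : ℂ)) ^ 12 ∧ (-(I * ((Real.sqrt (7 : ℝ) : ℝ) : ℂ))) ^ 12 = (I * ((Real.sqrt (7 : ℝ) : ℝ) : ℂ)) ^ 12 := by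
  constructor <;> ring

end Summit.HodgeConjecture.HodgeConjecture.Theorems.WeilTwelvefoldsSqrtMinus7.Negative

end
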